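import Summits.HodgeConjecture.HodgeConjecture.Theorems.F0P2rFamTransferHolds        -- ★ p842415 (this seat): FAM-TR + `isConstituentOf_of_isotypicComponent_eq_top`; pulls ★ `F0P2cOmegaLocalType`, ★ `F0P2cStubCI`, ★ p817128, ★ p816908, ★ `F0P3FinRepConstituentsExist`, the REL-ENGINE statement vocabulary
import Summits.HodgeConjecture.HodgeConjecture.Theorems.F0P3FinPartIsotypic           -- ★ `isotypicComponent_finRep_smoothPart_eq_top` (Flath: the finite part of `P` is isotypic of its type)
import Summits.HodgeConjecture.HodgeConjecture.Theorems.F0P2oGR90Prop522OfLetters      -- ★ N4 `GR90Prop522_of_letters` (⟸ N3, N6), ★ `xThetaCM` vocabulary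
import Summits.HodgeConjecture.HodgeConjecture.Theorems.F0P2oLocalLettersHold          -- ★ N3 `thetaType_nonsplit_jacquetModule_holds`; pulls ★ `F0P2pGR91NOfN3`, ★ `F0P2oU1LetterOfTower` (road (T): ★ U1-DISJOINT assembly, ★ `hDich_of_disjoint`)
import Summits.HodgeConjecture.HodgeConjecture.Theorems.F0P2oK1aWOfLetters             -- ★ `exists_forall_isThetaCenterChar` (a line-independent centre character)
import Summits.HodgeConjecture.HodgeConjecture.Theorems.F0P2oK1occ                     -- ★ `exists_units_not_isNorm_of_nonsplit`, ★ `continuous_of_isThetaCenterChar`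
import Summits.HodgeConjecture.HodgeConjecture.Theorems.F0P2gStubNSILocalLemmas         -- ★ `locF_eq_one_of_isSquare` (split places carry one line class)
import Literature.NumberTheory.GelbartRogawski1991.QuadExtSplittingCharLocalComponents  -- ★ `QuadExt.isSquare_of_smul_ne`
import Literature.NumberTheory.Automorphic.U3JacquetVanishingSupercuspidal              -- ★ N6 `u3_isSupercuspidal_iff_jacquet_eq_zero_holds`
import HarnessLib

/-!
# Crux `H413`, programme P2 — REL-ENGINE stub **CUSP-DICT** (the RELATIVE local theta dictionary) PROVED in-house:
# `stubCuspDict_holds : ‹F0P2E3RelEngine.StubCuspDict›` (statement BY PASTE, the Lines-local `CuspLabel` UNFOLDED; no `Lines` import)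

Cell hodgecm-mathlib (D-0151), FLOOR 0, crux item H413 = stmt-HodgeConjecture-24833, route of record `HCCMUnconditional` (no route verbs);
programme P2 (theta ∕ `hdictE`), desk F0P2-plan (g12) sub-line «REL-ENGINE» (prewrite `F0/P2/F0_P2E3RelEngine.prewrite.F0P2-plan-g12.lean`
36fa610d5283b423; REL ⟸ S2♯ ⊕ FAM-TR ⊕ REL♯ ⊕ CUSP-DICT), brief P2-D1 «CUSP-DICT in-house» (PLAN-P2.v12 §3; desk «=» 07:52:51Z with the ERRATUM
that the `LemD1_1AsPrinted` flag is void).  Author F0P2-p01 (g10).  THEOREMS ONLY (no `def`, no instance, no notation, no named fact, no `sorry`);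
`--supports stmt-HodgeConjecture-24833 --as helper`; never imports a `Cruxes/…/Lines` module (ref1 O50-1) — the stub's statement is PASTED
(prewrite :313–350) with the Lines-local abbreviation `CuspLabel L H μA P v` (prewrite :196–204) UNFOLDED at its two occurrences (s347 pattern:
the Lines fold `theorem stub_cuspDict : StubCuspDict := F0P2rCuspDictHolds.stubCuspDict_holds` elaborates by unfolding `CuspLabel`).

HONEST LABEL (D-0151): «HC_CM is proved only modulo the printed citations until rung 0 closes» — this file closes NO print letter and takes NO
letter as a hypothesis: every print input it composes is a ★ THEOREM of the tree today (N3 ★ `thetaType_nonsplit_jacquetModule_holds`, N6 ★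
`u3_isSupercuspidal_iff_jacquet_eq_zero_holds`, U1 via ★ road (T) «UP THE TOWER», Lem. D.1 (1) per place ★ `lemD1_1AsPrinted_chi`).

## THE STATEMENT (CUSP-DICT)
For the theta frame data `(H, e₁, dV, g, ιV)` of the crux, two automorphic measures, two discrete automorphic `P`, `P′` of `U(H)`, ONE `(μ, χ)`
and two lines `a, a′ ∈ (L⁺)ˣ` with `P_f ↩ ω_H(μ, a, χ)`, `P′_f ↩ ω_H(μ, a′, χ)` (★ `HasFinComponent` of Liu's carriers ★ `rhoAtLine … ιV a χ`): at every
finite place `v` of `L⁺`, «`P` has a supercuspidal local constituent at `v` iff `P′` has one» ⟺ `[a]_v = [a′]_v` (★ `locF`, local norm classes of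
`L = L⁺(√Δ)`).  [GelbartRogawski1991, §1.4 pp. 450–451, Lem. 5.1.2 p. 466, p. 467; GelbartRogawski1990, Prop. 5.2.2; HarrisKudlaSweet1996, Cor. 4.4;
Liu2021, Def. 4.11, App. D Lem. D.1.]

## THE PROOF (all ★)
* §2 **LOCAL TYPE CONTROL of `P` (Flath), per line**: `CuspLabel P v ⟺ X_v(μ, a, χ)` is supercuspidal (★ `xThetaCM`).  (⇒) the finite part of `P` is
  isotypic of type `ω_H(a)` (★ `F0P3FinPartIsotypic.isotypicComponent_finRep_smoothPart_eq_top`; `ω_H(a)` irreducible + admissible UNCONDITIONALLY, ★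
  `F0P2cStubCI`), so a local constituent of `P` at `v` is one of `ω_H(a) ∘ inclPlace v` (★ `IrrClass.IsConstituentOf.of_isotypicComponent_eq_top_comp`),
  hence of its irreducible type `τ_a = X_v(μ,a,χ) ∘ κ_v⁻¹` (★ `F0P2cOmegaLocalType.isLocalTypeAt_rhoAtLine_chi`, ★ p842415's bookkeeping), hence `≃ τ_a`
  (★ `nonempty_equiv_of_isIrreducible`); supercuspidality passes through the class (★ `isSupercuspidal_mk`, ★ `isSupercuspidal_comap_iff`), the
  equivalence (★ `IsSupercuspidal.of_equiv`) and the frame congruence `κ_v` (★ `IsSupercuspidal.comp_continuousMulEquiv`).  (⇐) push a constituent of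
  `ω_H(a) ∘ inclPlace v` into `P` along `hfin` (★ `isConstituentOf_finRepSmooth_comp_of_hasFinComponent`).
* §3 **THE RELATIVE DICTIONARY ON LIU'S LOCAL TYPES**: «`X_v(μ,a,χ)` s.c. ⟺ `X_v(μ,a′,χ)` s.c.» ⟺ `[a]_v = [a′]_v`.  SPLIT `v`: one class (★
  `isSquare_of_smul_ne`, ★ `locF_eq_one_of_isSquare`) and `τ_a ≃ Ind(θ_w∘det ⊠ χ′_w θ_w⁻²) ∘ localPiSplitEquiv ≃ τ_{a′}` (★ p817128 + ★ p816908, line-free, at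
  the frame `H := diag dV`, `g := 1`).  NON-SPLIT `v`: a centre character `ψθ` serving EVERY line (★ `exists_forall_isThetaCenterChar`); [GR90 Prop. 5.2.2] ★
  `GR90Prop522_of_letters N3★ N6★`: `X_v(μ,ε,χ)` s.c. ⟺ `ψθ` does not occur in `ω¹_ε`; the exact `(U(1),U(1))` dichotomy ★ `hDich_of_disjoint (u1Disjoint_of_letters N3★ ★ h4★ ★)`:
  for `ε₂/ε₁ ∉ N(L_wˣ)` exactly one of `ω¹_{ε₁}`, `ω¹_{ε₂}` carries `ψθ`; the same-class half through a third line `θ·a` in the other class (★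
  `exists_units_not_isNorm_of_nonsplit`); classes read through §1 `locF_apply_eq_iff_exists_norm` (★ `isNorm_iff_mem_quadraticNormSubgroup`).
* §4 the closer: §2 at `(P, a)` and `(P′, a′)`, then §3.

## References
* [GelbartRogawski1991] S. Gelbart, J. Rogawski, Invent. Math. 105 (1991): §1.4 pp. 450–451; §3.2 (3.2.1)–(3.2.3) p. 457; §5.1 (5.1.1), Lem. 5.1.2 p. 466;
  Remark p. 466; §5.2 p. 467.  [GelbartRogawski1990] S. Gelbart, J. Rogawski, Festschrift Piatetski-Shapiro (1990): Prop. 5.2.2.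
* [HarrisKudlaSweet1996] M. Harris, S. Kudla, W. Sweet, JAMS 9 (1996): Cor. 4.4 p. 962, Thm. 6.1.  [MoeglinVignerasWaldspurger1987] LNM 1291: Chap. 3 §IV.4.
* [Liu2021] Y. Liu, Camb. J. Math. 9 (2021) = arXiv:2102.11518: Def. 4.11 (l. 2090–2096), Def. 4.12, App. D §D.1, Lem. D.1 (1), (3), (4), proof ¶1 p. 126.
* [Rogawski1990] J. Rogawski, Ann. of Math. Stud. 123: §12.2 pp. 173–174; §13.1 p. 199; Lemma 4.13.1 (b).  [Flath1979] D. Flath, PSPM 33.1: Thm. 3.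
* [Omeara1963] O. T. O'Meara, *Introduction to quadratic forms*: §63 (local norm groups).  [BushnellHenniart2006] §1.1, §2, §10.1.
-/

set_option autoImplicit false
-- the mandated namespace has the single-problem summit's repeated segment (`HodgeConjecture.HodgeConjecture`)
set_option linter.dupNamespace false

noncomputable section

open scoped Matrix Kronecker MatrixGroups MonoidAlgebra ComplexOrder
open NumberField NumberField.InfinitePlace IsDedekindDomain MeasureTheory
open Literature.NumberTheory Literature.NumberTheory.Automorphic Literature.NumberTheory.Automorphic.UnitaryGroup
open Literature.NumberTheory.Automorphic.UnitaryGroup.CotangentForms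
open Literature.NumberTheory.Automorphic.Liu2021 Literature.NumberTheory.Automorphic.Liu2021.AppendixC
open Literature.NumberTheory.Automorphic.Liu2021.Def411WeilCarriers
open Literature.NumberTheory.Automorphic.Liu2021.Def411WeilCarriersDoubling
open Literature.NumberTheory.Automorphic.IdeleClassGroup
open Literature.NumberTheory.GelbartRogawski1991 Literature.NumberTheory.GelbartRogawski1991.UnitaryDualPair
open Literature.NumberTheory.GelbartRogawski1991.UnitaryDualPair.WeilCoinv
open Literature.NumberTheory.GelbartRogawski1991.UnitaryDualPair.LocalSplitting
open Literature.RepresentationTheory Literature.RepresentationTheory.Liu2021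
open Literature.NumberTheory.GaloisRepresentations Literature.RepresentationTheory.HarrisKudlaSweet1996
open Literature.NumberTheory.Rogawski1990
open Summit.HodgeConjecture.CorCM
open Summit.HodgeConjecture.CorCM.Transposition
open Summit.HodgeConjecture.HodgeConjecture.Cruxes.H413

namespace Summit.HodgeConjecture.HodgeConjecture.Cruxes.H413.F0P2rCuspDictHolds

/-! ## §0 Bookkeeping: supercuspidality along an isomorphism of topological groups, both ways -/

/-- **`ρ ∘ e` is supercuspidal iff `ρ` is**, for an isomorphism of topological groups `e : G′ ≃ₜ* G` (Harish-Chandra's «smooth matrix coefficients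
compactly supported modulo the centre» transports along `e` and `e⁻¹`, ★ `Representation.IsSupercuspidal.comp_continuousMulEquiv`; `(ρ ∘ e) ∘ e⁻¹ = ρ`).
Stated with `e.toMulEquiv.toMonoidHom`, the spelling of the frame congruence `κ_v⁻¹` in ★ `F0P2cOmegaLocalType` ∕ ★ `ThetaTypeAtCM`.
[cite: HarishChandra1970, Part I §3 p. 9] [cite: BushnellHenniart2006, §10.1] -/
theorem isSupercuspidal_comp_toMonoidHom_iff {G G' : Type} [Group G] [TopologicalSpace G] [IsTopologicalGroup G]
    [Group G'] [TopologicalSpace G'] [IsTopologicalGroup G'] {V : Type*} [AddCommGroup V] [Module ℂ V]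
    (ρ : Representation ℂ G V) (e : G' ≃ₜ* G) :
    Representation.IsSupercuspidal (V := V) (ρ.comp e.toMulEquiv.toMonoidHom) ↔ ρ.IsSupercuspidal := by
  constructor
  · intro h
    have h' := h.comp_continuousMulEquiv e.symm
    have hE : ((ρ.comp e.toMulEquiv.toMonoidHom).comp (e.symm : G →* G')) = ρ :=
      MonoidHom.ext fun x => congrArg (fun y => ρ y) (e.apply_symm_apply x)
    rw [hE] at h'
    exact h'
  · intro h
    exact h.comp_continuousMulEquiv e

/-! ## §1 Line classes `[a]_v` and local norms from `L_w = L ⊗ L⁺_v` -/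

/-- **`[a]_v = [a′]_v` iff `a′/a` is a local norm from `L ⊗ L⁺_v`**: the `v`-components of [Liu2021, Def. 4.12]'s collections `locF a`, `locF a′`
(classes in `(L⁺_v)ˣ/{p² − Δ q²}`, `Δ = imagUnitSq L`) agree iff `∃ x ∈ (L ⊗ L⁺_v)ˣ, x·x̄ = a′ a⁻¹` — the currency of the road-(T) dichotomy ★
`F0P2oU1DichotomyOfDisjoint.hDich_of_disjoint` (★ `isNorm_iff_mem_quadraticNormSubgroup`, `x = ι_v p + ι_v q·(δ ⊗ 1)`).
[cite: Liu2021, Def. 4.12 (l. 2105); App. D §D.1 Step 1 (l. 5217)] [cite: Omeara1963, §63B] -/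
theorem locF_apply_eq_iff_exists_norm (L : Type) [Field L] [NumberField L] [IsCMField L]
    (v : HeightOneSpectrum (𝓞 ↥(maximalRealSubfield L))) (a a' : (↥(maximalRealSubfield L))ˣ) :
    locF (↥(maximalRealSubfield L)) (imagUnitSq L) a v = locF (↥(maximalRealSubfield L)) (imagUnitSq L) a' v ↔
      ∃ x : (UnitaryGroup.LocalRing L v)ˣ,
        (x : UnitaryGroup.LocalRing L v) * conjLocal L (IsCMField.complexConj L) v x =
          algebraMap L (UnitaryGroup.LocalRing L v) (((a' * a⁻¹ : (↥(maximalRealSubfield L))ˣ) : ↥(maximalRealSubfield L)) : L) := by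
  rw [locF_apply, locF_apply, QuotientGroup.eq, ← map_inv, ← map_mul, mul_comm]
  refine (Liu2021.LemD1IndexedNonVacuityNonsplitPlace.isNorm_iff_mem_quadraticNormSubgroup L v (IsCMField.complexConj L)
      (complexConj_imagUnit L) (imagUnit_ne_zero L) (imagUnit_mul_self L) _).symm.trans ?_
  have hc : algebraMap (v.adicCompletion ↥(maximalRealSubfield L)) (UnitaryGroup.LocalRing L v)
        ((Units.map (algebraMap (↥(maximalRealSubfield L)) (v.adicCompletion ↥(maximalRealSubfield L))).toMonoidHom (a' * a⁻¹) :
          (v.adicCompletion ↥(maximalRealSubfield L))ˣ)) =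
      algebraMap L (UnitaryGroup.LocalRing L v) (((a' * a⁻¹ : (↥(maximalRealSubfield L))ˣ) : ↥(maximalRealSubfield L)) : L) := by
    rw [Units.coe_map]
    change algebraMap (v.adicCompletion ↥(maximalRealSubfield L)) (UnitaryGroup.LocalRing L v)
        (algebraMap (↥(maximalRealSubfield L)) (v.adicCompletion ↥(maximalRealSubfield L))
          ((a' * a⁻¹ : (↥(maximalRealSubfield L))ˣ) : ↥(maximalRealSubfield L))) =
      algebraMap L (UnitaryGroup.LocalRing L v) (algebraMap (↥(maximalRealSubfield L)) L
          ((a' * a⁻¹ : (↥(maximalRealSubfield L))ˣ) : ↥(maximalRealSubfield L)))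
    rw [← IsScalarTower.algebraMap_apply, ← IsScalarTower.algebraMap_apply]
  rw [hc]

/-! ## §2 Local type control of `P` (Flath + Liu): `CuspLabel P v ⟺ X_v(μ, a, χ)` is supercuspidal -/

set_option synthInstance.maxHeartbeats 400000 in
set_option maxHeartbeats 16000000 in
/-- **THE SUPERCUSPIDAL LABEL OF `P` AT `v` READS LIU'S LOCAL THETA TYPE.**  For the theta frame data `(H, e₁, dV, g, ιV)` (`ιV k = g_f⁻¹ k g_f`), an
automorphic measure, a discrete automorphic `P` of `U(H)` with `P_f ↩ ω_H(μ, ε, χ)` (★ `HasFinComponent` of ★ `rhoAtLine … ιV ε χ` at the `μ`-attached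
splittings) and a finite place `v` of `L⁺`: `P` has a SUPERCUSPIDAL local constituent at `v` (the REL-ENGINE label `CuspLabel L H μA P v`, unfolded: some
class `c` of `U(H)(L⁺_v)` read through ★ `localPiEquiv v` is a constituent of `P.finRep^∞ ∘ inclPlace v` and is supercuspidal) IFF Liu's local theta type
`X_v(μ, ε, χ)` (★ `xThetaCM … χ.1 ε v`) is supercuspidal.  The finite part of `P` is isotypic of type `ω_H(ε)` (★ `isotypicComponent_finRep_smoothPart_eq_top`,
[Flath1979, Thm. 3]; `ω_H(ε)` irreducible + admissible ★ `F0P2cStubCI`), `ω_H(ε) ∘ inclPlace v` is isotypic of the irreducible `X_v(μ,ε,χ) ∘ κ_v⁻¹`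
(★ `isLocalTypeAt_rhoAtLine_chi`, [Liu2021, Def. 4.11, Lem. D.1 (1)]), so every local constituent of `P` at `v` IS that type up to equivalence.
[cite: Flath1979, Thm. 3] [cite: Liu2021, Def. 4.11 (l. 2090–2096); App. D Lem. D.1 (1)] [cite: BushnellHenniart2006, §1.1, §2, §10.1] [cite: Rogawski1990, §13.1 p. 199] -/
theorem cuspLabel_iff_isSupercuspidal_xThetaCM
    (L : Type) [Field L] [NumberField L] [IsCMField L] (H : Matrix (Fin 3) (Fin 3) L)
    {n' : ℕ} (e₁ : Fin 3 × Fin 1 ≃ Fin n') (dV : Fin 3 → L) (hdV : ∀ i, IsCMField.complexConj L (dV i) = dV i) (hdV0 : ∀ i, dV i ≠ 0)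
    (g : GL (Fin 3) L)
    (hg : ((g : Matrix (Fin 3) (Fin 3) L).map (cmConjRingHom L))ᵀ * H * (g : Matrix (Fin 3) (Fin 3) L) = Matrix.diagonal dV)
    (ιV : finAdelic (↥(maximalRealSubfield L)) L (IsCMField.complexConj L) 3 H →*
        finAdelic (↥(maximalRealSubfield L)) L (IsCMField.complexConj L) 3 (Matrix.diagonal dV))
    (hιV : ∀ k, ((ιV k : finAdelic (↥(maximalRealSubfield L)) L (IsCMField.complexConj L) 3 (Matrix.diagonal dV)) :
          GL (Fin 3) (FiniteAdeleRing (𝓞 L) L)) =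
        (toFinAdeleGL L 3 g)⁻¹ * (k : GL (Fin 3) (FiniteAdeleRing (𝓞 L) L)) * toFinAdeleGL L 3 g)
    (μA : Measure (adelicGroupData (↥(maximalRealSubfield L)) L (IsCMField.complexConj L) 3 H).automorphicQuotient)
    [(adelicGroupData (↥(maximalRealSubfield L)) L (IsCMField.complexConj L) 3 H).IsAutomorphicMeasure μA]
    (P : DiscreteAutomorphicRep (adelicGroupData (↥(maximalRealSubfield L)) L (IsCMField.complexConj L) 3 H) μA)
    (μ : Literature.NumberTheory.Automorphic.IdeleClassGroup L →ₜ* Circle) (hμ : IsConjugateSymplectic L μ)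
    (ε : (↥(maximalRealSubfield L))ˣ) (χ : Chi (↥(maximalRealSubfield L)) L (IsCMField.complexConj L))
    (hfin : P.HasFinComponent
      (rhoAtLine (↥(maximalRealSubfield L)) L (IsCMField.complexConj L) 3 e₁ (Matrix.diagonal dV)
        (complexConj_imagUnit L) (imagUnit_ne_zero L) (imagUnit_mul_self L) (realDiagonal_isSymm L dV hdV)
        (isUnit_det_realDiagonal L dV hdV hdV0) (realDiagonal_map L dV hdV).symm
        (fun a => isCompatible_chiSplittingLine L e₁ dV hdV hdV0 (toHeckeCharacter L μ)
          (isUnitary_toHeckeCharacter L μ) ((isOscillatorChar_toHeckeCharacter_iff μ).mpr hμ)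
          (TW (↥(maximalRealSubfield L)) a) (isSymm_TW (↥(maximalRealSubfield L)) a)
          (isUnit_det_TW (↥(maximalRealSubfield L)) a) (JW (↥(maximalRealSubfield L)) L a)
          (JW_eq (↥(maximalRealSubfield L)) L a)) ιV ε χ))
    (v : HeightOneSpectrum (𝓞 ↥(maximalRealSubfield L))) :
    (∃ c : IrrClass ((cmDatum L 3 H).Local v),
        (IrrClass.comap (localPiEquiv L (IsCMField.complexConj L) 3 H v) c).IsConstituentOf
            (P.finRep.smoothPart.toRepresentation.comp (inclPlace (↥(maximalRealSubfield L)) L (IsCMField.complexConj L) 3 H v)) ∧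
          c.IsSupercuspidal) ↔
      (xThetaCM L e₁ dV hdV hdV0 μ hμ χ.1 ε v).IsSupercuspidal := by
  have hirr := F0P2cStubCI.rhoAtLine_chi_isIrreducible L H e₁ dV hdV hdV0 g hg ιV hιV μ hμ ε χ
  have hadm := F0P2cStubCI.rhoAtLine_chi_isAdmissible L H e₁ dV hdV hdV0 g hg ιV hιV μ hμ ε χ
  obtain ⟨hτ, hτtop⟩ := F0P2cOmegaLocalType.isLocalTypeAt_rhoAtLine_chi L H e₁ dV hdV hdV0 g hg ιV hιV μ hμ ε χ v
  have htopP := F0P3FinPartIsotypic.isotypicComponent_finRep_smoothPart_eq_top P _ hirr hadm hfin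
  -- `X_v(μ, ε, χ) ∘ κ_v⁻¹` (the type of `ω_H(ε) ∘ inclPlace v` on `U(H)(L⁺_v)`) is supercuspidal iff `X_v(μ, ε, χ)` is
  have hXτ := isSupercuspidal_comp_toMonoidHom_iff (xThetaCM L e₁ dV hdV hdV0 μ hμ χ.1 ε v)
    (localCongr L (IsCMField.complexConj L) g one_ne_zero (F0P2cOmegaLocalType.formCongr_frame L H dV g hg) v).symm
  constructor
  · rintro ⟨c, hc, hsc⟩
    haveI := hirr
    -- a local constituent of `P` at `v` is one of `ω_H(ε) ∘ inclPlace v` (Flath), hence of its irreducible type `τ_ε`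
    have h₁ := hc.of_isotypicComponent_eq_top_comp htopP (inclPlace (↥(maximalRealSubfield L)) L (IsCMField.complexConj L) 3 H v)
    have h₂ := F0P2rFamTransferHolds.isConstituentOf_of_isotypicComponent_eq_top hτtop h₁
    obtain ⟨r, hr⟩ := IrrClass.mk_surjective (IrrClass.comap (localPiEquiv L (IsCMField.complexConj L) 3 H v) c)
    rw [← hr] at h₂
    obtain ⟨er⟩ := h₂.nonempty_equiv_of_isIrreducible
    have hrsc : r.ρ.IsSupercuspidal := by
      rw [← IrrClass.isSupercuspidal_mk, hr]
      exact hsc.comap _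
    exact hXτ.1 (hrsc.of_equiv er)
  · intro hX
    -- a constituent of `ω_H(ε) ∘ inclPlace v`, pushed into `P` along `hfin`; it is `≃ τ_ε`, hence supercuspidal
    obtain ⟨c₀, hc₀⟩ := F0P3FinRepConstituentsExist.exists_isConstituentOf_comp_inclPlace hirr hadm.isSmooth v
    have hP : (IrrClass.comap (localPiEquiv L (IsCMField.complexConj L) 3 H v)
        (IrrClass.comap (localPiEquiv L (IsCMField.complexConj L) 3 H v).symm c₀)).IsConstituentOf
        (P.finRep.smoothPart.toRepresentation.comp (inclPlace (↥(maximalRealSubfield L)) L (IsCMField.complexConj L) 3 H v)) := by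
      rw [IrrClass.comap_comap_symm]
      exact F0P3FinRepConstituentsExist.isConstituentOf_finRepSmooth_comp_of_hasFinComponent P hadm.isSmooth hfin hc₀
    obtain ⟨r, rfl⟩ := IrrClass.mk_surjective c₀
    have h₂ := F0P2rFamTransferHolds.isConstituentOf_of_isotypicComponent_eq_top hτtop hc₀
    obtain ⟨er⟩ := h₂.nonempty_equiv_of_isIrreducible
    have hsc : (IrrClass.comap (localPiEquiv L (IsCMField.complexConj L) 3 H v).symm (IrrClass.mk r)).IsSupercuspidal :=
      ((IrrClass.isSupercuspidal_mk r).2 ((hXτ.2 hX).of_equiv er.symm)).comap _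
    exact ⟨_, hP, hsc⟩

/-! ## §3 The relative dictionary on Liu's local theta types -/

set_option synthInstance.maxHeartbeats 400000 in
set_option maxHeartbeats 16000000 in
/-- **THE RELATIVE LOCAL THETA DICTIONARY** (no statement about WHICH class is the supercuspidal one): for the rational theta frame `(e₁, dV)`,
conjugate-symplectic `μ`, `χ ∈ Chi`, two lines `a, a′ ∈ (L⁺)ˣ` and a finite place `v` of `L⁺`:
«`X_v(μ, a, χ)` supercuspidal ⟺ `X_v(μ, a′, χ)` supercuspidal» ⟺ `[a]_v = [a′]_v`.  SPLIT `v` (`δ²` a square in `L⁺_v`, ★ `isSquare_of_smul_ne`): one class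
(★ `locF_eq_one_of_isSquare`) and the two local types are equivalent — both are `Ind_{Q_{2,1}}^{GL₃(L_w)}((θ_w∘det) ⊠ χ′_w θ_w⁻²)` read back on `U(diag dV)(L⁺_v)`
(★ p817128 `F0P2iXvSplitModel` + ★ p816908 `F0P2iGRDSplitTransport` at the frame `H := diag dV`, `g := 1`; [Liu2021, App. D proof of Lem. D.1 ¶1]).  NON-SPLIT `v`:
with ONE centre character `ψθ` serving every line (★ `exists_forall_isThetaCenterChar`), [GelbartRogawski1990, Prop. 5.2.2] (★ `GR90Prop522_of_letters` at the ★
letters N3, N6) reads «`X_v(μ, ε, χ)` s.c.» as «`ψθ` does not occur in `ω¹_ε`», and the exact `(U(1),U(1))` theta dichotomy ([HarrisKudlaSweet1996, Cor. 4.4]; ★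
`hDich_of_disjoint` at the ★ road-(T) assembly `u1Disjoint_of_letters`) says that of two lines in DIFFERENT classes exactly one carries `ψθ`; for two lines in the
SAME class compare both with a third line `θ·a` of the other class (★ `exists_units_not_isNorm_of_nonsplit`).
[cite: GelbartRogawski1990, Prop. 5.2.2] [cite: GelbartRogawski1991, §5.2 p. 467; Remark p. 466; Lem. 5.1.2 p. 466] [cite: HarrisKudlaSweet1996, Cor. 4.4 p. 962]
[cite: Liu2021, Def. 4.11; Def. 4.12; App. D Lem. D.1 (3)–(4), proof ¶1 p. 126] [cite: MoeglinVignerasWaldspurger1987, Chap. 3 §IV.4] [cite: Omeara1963, §63] -/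
theorem isSupercuspidal_xThetaCM_iff_iff_locF_apply_eq
    (L : Type) [Field L] [NumberField L] [IsCMField L] (e₁ : Fin 3 × Fin 1 ≃ Fin 3) (dV : Fin 3 → L)
    (hdV : ∀ i, IsCMField.complexConj L (dV i) = dV i) (hdV0 : ∀ i, dV i ≠ 0)
    (μ : Literature.NumberTheory.Automorphic.IdeleClassGroup L →ₜ* Circle) (hμ : IsConjugateSymplectic L μ)
    (χ : Chi (↥(maximalRealSubfield L)) L (IsCMField.complexConj L)) (a a' : (↥(maximalRealSubfield L))ˣ)
    (v : HeightOneSpectrum (𝓞 ↥(maximalRealSubfield L))) :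
    ((xThetaCM L e₁ dV hdV hdV0 μ hμ χ.1 a v).IsSupercuspidal ↔ (xThetaCM L e₁ dV hdV hdV0 μ hμ χ.1 a' v).IsSupercuspidal) ↔
      locF (↥(maximalRealSubfield L)) (imagUnitSq L) a v = locF (↥(maximalRealSubfield L)) (imagUnitSq L) a' v := by
  have hχu := Def411WeilCarriers.norm_chi_eq_one_cm L χ
  by_cases hv : ∀ w : PlacesOver L v, IsCMField.complexConj L • w.1 = w.1
  · /- NON-SPLIT `v` -/
    -- a centre character serving every line
    obtain ⟨ψθ, hψθ⟩ := F0P2oK1aWOfLetters.exists_forall_isThetaCenterChar L μ χ.1 v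
    have hψc := F0P2oK1occ.continuous_of_isThetaCenterChar L μ χ.1 χ.2.1 a v ψθ (hψθ a)
    -- [GelbartRogawski1990 Prop. 5.2.2] in-house (N3 ★, N6 ★): `X_v(μ, ε, χ)` supercuspidal iff `ψθ` does not occur in `ω¹_ε`
    have h522 := fun ε : (↥(maximalRealSubfield L))ˣ =>
      F0P2oGR90Prop522OfLetters.GR90Prop522_of_letters F0P2oLineJacquetHolds.thetaType_nonsplit_jacquetModule_holds
        Literature.NumberTheory.Rogawski1990.u3_isSupercuspidal_iff_jacquet_eq_zero_holds L e₁ dV hdV hdV0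
        (Equiv.prodUnique (Fin 1) (Fin 1)) μ hμ χ.1 χ.2.1 hχu v hv ε ψθ (hψθ ε)
    -- the exact `(U(1), U(1))` dichotomy, in-house over road (T) «UP THE TOWER»
    have hD := F0P2oU1DichotomyOfDisjoint.hDich_of_disjoint
      (F0P2oU1DisjointOfTower.u1Disjoint_of_letters F0P2oLineJacquetHolds.thetaType_nonsplit_jacquetModule_holds
        F0P2oThetaCenterCharGlobalise.exists_chi_isThetaCenterChar
        (F0P2pPrincipalSeriesUniqueSubCM.principalSeries_uniqueSub fun L _ _ _ =>
          F0P3U3PrincipalSeriesJacquetFiltrationHolds.U3PrincipalSeriesJacquetFiltration_holds_of_lineAction L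
            (F0P3U3PrincipalSeriesOpenCellTorusChar.torus_normalizedJacquet_openCellLine_eq_weylChar L))
        F0P2oXThetaLineRigidity.exists_mul_conj_eq_ratio_of_areIsomorphicRep_xThetaCM)
      L (Equiv.prodUnique (Fin 1) (Fin 1)) (kernelLineCM dV) (complexConj_kernelLineCM dV hdV) (kernelLineCM_ne_zero dV hdV0) μ hμ v hv
    rw [h522 a, h522 a', locF_apply_eq_iff_exists_norm]
    constructor
    · -- different classes ⟹ exactly one of `X_v(a)`, `X_v(a′)` is supercuspidal
      intro h
      by_contra hne
      obtain ⟨hor, hand⟩ := hD a a' hne ψθ hψc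
      rcases hor with h₁ | h₂
      · exact hand ⟨h₁, not_not.1 fun h₂ => h.2 h₂ h₁⟩
      · exact hand ⟨not_not.1 fun h₁ => h.1 h₁ h₂, h₂⟩
    · -- same class ⟹ compare both with a third line `θ·a` in the other class
      rintro ⟨y, hy⟩
      obtain ⟨θ, hθ⟩ := F0P2oK1occ.exists_units_not_isNorm_of_nonsplit L v hv
      have hne₁ : ¬ ∃ x : (UnitaryGroup.LocalRing L v)ˣ,
          (x : UnitaryGroup.LocalRing L v) * conjLocal L (IsCMField.complexConj L) v x =
            algebraMap L (UnitaryGroup.LocalRing L v)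
              (((θ * a * a⁻¹ : (↥(maximalRealSubfield L))ˣ) : ↥(maximalRealSubfield L)) : L) := by
        rw [mul_inv_cancel_right]
        exact hθ
      have hne₂ : ¬ ∃ x : (UnitaryGroup.LocalRing L v)ˣ,
          (x : UnitaryGroup.LocalRing L v) * conjLocal L (IsCMField.complexConj L) v x =
            algebraMap L (UnitaryGroup.LocalRing L v)
              (((θ * a * a'⁻¹ : (↥(maximalRealSubfield L))ˣ) : ↥(maximalRealSubfield L)) : L) := by
        rintro ⟨x, hx⟩
        refine hθ ⟨x * y, ?_⟩
        have hu : θ * a * a'⁻¹ * (a' * a⁻¹) = θ := by group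
        rw [Units.val_mul, map_mul, mul_mul_mul_comm, hx, hy, ← map_mul, ← MulMemClass.coe_mul, ← Units.val_mul, hu]
      obtain ⟨hor₁, hand₁⟩ := hD a (θ * a) hne₁ ψθ hψc
      obtain ⟨hor₂, hand₂⟩ := hD a' (θ * a) hne₂ ψθ hψc
      exact ⟨fun hna hOa' => hand₂ ⟨hOa', hor₁.resolve_left hna⟩, fun hna' hOa => hand₁ ⟨hOa, hor₂.resolve_left hna'⟩⟩
  · /- SPLIT `v` -/
    obtain ⟨w, hw⟩ := not_forall.mp hv
    have hsq := QuadExt.isSquare_of_smul_ne (↥(maximalRealSubfield L)) L (IsCMField.complexConj L) (imagUnit_mul_self L) v w hw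
    refine iff_of_true ?_ (by rw [F0P2gStubNSILocalLemmas.locF_eq_one_of_isSquare L hsq a,
      F0P2gStubNSILocalLemmas.locF_eq_one_of_isSquare L hsq a'])
    -- the split model at `w`, line-free, transported to `U(diag dV)(L⁺_v)` at the frame `H := diag dV`, `g := 1`
    have hc1 : IsCMField.complexConj L ≠ 1 := IsCMField.complexConj_ne_one L
    have hH : ((Matrix.diagonal dV).map (cmConjRingHom L))ᵀ = Matrix.diagonal dV := F0P2oU1DisjointOfTower.diagonal_isHermitian dV hdV
    have hHh : ((Matrix.diagonal dV).map (IsCMField.complexConj L))ᵀ = Matrix.diagonal dV :=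
      (UnitaryGroup.map_cmConjRingHom_eq_map_complexConj L (Matrix.diagonal dV)) ▸ hH
    have hHw : IsUnit (placeForm (Matrix.diagonal dV) w.1) :=
      UnitaryGroup.isUnit_placeForm_of_isUnit_det (F0P2oU1DisjointOfTower.isUnit_det_diagonal dV hdV0) w.1
    have hJh := reindex_kronecker_JW_hermitian (↥(maximalRealSubfield L)) L (IsCMField.complexConj L) 3 e₁ (Matrix.diagonal dV)
      (realDiagonal_isSymm L dV hdV) (realDiagonal_map L dV hdV).symm a
    have hJh' := reindex_kronecker_JW_hermitian (↥(maximalRealSubfield L)) L (IsCMField.complexConj L) 3 e₁ (Matrix.diagonal dV)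
      (realDiagonal_isSymm L dV hdV) (realDiagonal_map L dV hdV).symm a'
    have hJw : IsUnit (placeForm (Matrix.reindex e₁ e₁ (Matrix.diagonal dV ⊗ₖ JW (↥(maximalRealSubfield L)) L a)) w.1) :=
      UnitaryGroup.isUnit_placeForm_of_isUnit_det
        (isUnit_iff_ne_zero.2 (det_reindex_kronecker_JW_ne_zero (↥(maximalRealSubfield L)) L 3 e₁ (Matrix.diagonal dV)
          (isUnit_det_realDiagonal L dV hdV hdV0) (realDiagonal_map L dV hdV).symm a)) w.1
    have hJw' : IsUnit (placeForm (Matrix.reindex e₁ e₁ (Matrix.diagonal dV ⊗ₖ JW (↥(maximalRealSubfield L)) L a')) w.1) :=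
      UnitaryGroup.isUnit_placeForm_of_isUnit_det
        (isUnit_iff_ne_zero.2 (det_reindex_kronecker_JW_ne_zero (↥(maximalRealSubfield L)) L 3 e₁ (Matrix.diagonal dV)
          (isUnit_det_realDiagonal L dV hdV hdV0) (realDiagonal_map L dV hdV).symm a')) w.1
    have hXI := F0P2iXvSplitModel.areIsomorphicRep_chiCoinv_chiLocalSplittingsD_split L hc1 (by norm_num) e₁ dV hdV hdV0
      (toHeckeCharacter L μ) ((isOscillatorChar_toHeckeCharacter_iff μ).mpr hμ) (isUnitary_toHeckeCharacter L μ) a χ.1 hχu χ.2.1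
      v w hw hJh hJw _ (F0P2iGRDSplit.wReading_det_eq_localCharOfCenter L a χ.1 v w hw)
    have hXI' := F0P2iXvSplitModel.areIsomorphicRep_chiCoinv_chiLocalSplittingsD_split L hc1 (by norm_num) e₁ dV hdV hdV0
      (toHeckeCharacter L μ) ((isOscillatorChar_toHeckeCharacter_iff μ).mpr hμ) (isUnitary_toHeckeCharacter L μ) a' χ.1 hχu χ.2.1
      v w hw hJh' hJw' _ (F0P2iGRDSplit.wReading_det_eq_localCharOfCenter L a' χ.1 v w hw)
    obtain ⟨Ea⟩ := F0P2iGRDSplitTransport.nonempty_equiv_comp_localLineInl_localCongr_symm L (Matrix.diagonal dV) dV 1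
      (F0P2oU1DisjointOfTower.one_frame dV) e₁ (JW (↥(maximalRealSubfield L)) L a) v w hw hc1 hHh hHw hJh hJw _ _ hXI
    obtain ⟨Ea'⟩ := F0P2iGRDSplitTransport.nonempty_equiv_comp_localLineInl_localCongr_symm L (Matrix.diagonal dV) dV 1
      (F0P2oU1DisjointOfTower.one_frame dV) e₁ (JW (↥(maximalRealSubfield L)) L a') v w hw hc1 hHh hHw hJh' hJw' _ _ hXI'
    have E := Ea.trans Ea'.symm
    have hXa := isSupercuspidal_comp_toMonoidHom_iff (xThetaCM L e₁ dV hdV hdV0 μ hμ χ.1 a v)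
      (localCongr L (IsCMField.complexConj L) 1 one_ne_zero
        (F0P2cOmegaLocalType.formCongr_frame L (Matrix.diagonal dV) dV 1 (F0P2oU1DisjointOfTower.one_frame dV)) v).symm
    have hXa' := isSupercuspidal_comp_toMonoidHom_iff (xThetaCM L e₁ dV hdV hdV0 μ hμ χ.1 a' v)
      (localCongr L (IsCMField.complexConj L) 1 one_ne_zero
        (F0P2cOmegaLocalType.formCongr_frame L (Matrix.diagonal dV) dV 1 (F0P2oU1DisjointOfTower.one_frame dV)) v).symm
    exact ⟨fun h => hXa'.1 ((hXa.2 h).of_equiv E), fun h => hXa.1 ((hXa'.2 h).of_equiv E.symm)⟩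

/-! ## §4 CUSP-DICT -/

set_option synthInstance.maxHeartbeats 400000 in
set_option maxHeartbeats 16000000 in
/-- **CUSP-DICT — THE RELATIVE LOCAL THETA DICTIONARY FOR `P`, `P′` (the REL-ENGINE stub `stub_cuspDict`, statement `StubCuspDict` token for token with
the Lines-local `CuspLabel` unfolded).**  If `P_f ↩ ω_H(μ, a, χ)` and `P′_f ↩ ω_H(μ, a′, χ)` (same hermitian space `H`, same theta frame, same `(μ, χ)`),
then at every finite place `v` of `L⁺`: «`P` has a supercuspidal local constituent at `v` iff `P′` has one» ⟺ `[a]_v = [a′]_v`.  Proof: §2 at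
`(P, a)` and at `(P′, a′)` (the labels read Liu's local theta types `X_v(μ, a, χ)`, `X_v(μ, a′, χ)`), then §3.  No letter hypothesis; RELATIVE (nothing is
said about which class is the supercuspidal one).
[cite: GelbartRogawski1991, §1.4 pp. 450–451; Lem. 5.1.2 p. 466; §5.2 p. 467] [cite: GelbartRogawski1990, Prop. 5.2.2] [cite: HarrisKudlaSweet1996, Cor. 4.4, Thm. 6.1]
[cite: Liu2021, Def. 4.11; App. D Lem. D.1 (1), (3), (4)] [cite: Flath1979, Thm. 3] [cite: Rogawski1990, §12.2 pp. 173–174; Lemma 4.13.1 (b)] -/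
theorem stubCuspDict_holds :
  ∀ (L : Type) [Field L] [NumberField L] [IsCMField L] (H : Matrix (Fin 3) (Fin 3) L),
    ∀ {n' : ℕ} (e₁ : Fin 3 × Fin 1 ≃ Fin n') (dV : Fin 3 → L) (hdV : ∀ i, IsCMField.complexConj L (dV i) = dV i)
      (hdV0 : ∀ i, dV i ≠ 0) (g : GL (Fin 3) L)
      (hg : ((g : Matrix (Fin 3) (Fin 3) L).map (cmConjRingHom L))ᵀ * H * (g : Matrix (Fin 3) (Fin 3) L) = Matrix.diagonal dV)
      (ιV : finAdelic (↥(maximalRealSubfield L)) L (IsCMField.complexConj L) 3 H →*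
          finAdelic (↥(maximalRealSubfield L)) L (IsCMField.complexConj L) 3 (Matrix.diagonal dV)),
        (∀ k, ((ιV k : finAdelic (↥(maximalRealSubfield L)) L (IsCMField.complexConj L) 3 (Matrix.diagonal dV)) :
            GL (Fin 3) (FiniteAdeleRing (𝓞 L) L)) =
          (toFinAdeleGL L 3 g)⁻¹ * (k : GL (Fin 3) (FiniteAdeleRing (𝓞 L) L)) * toFinAdeleGL L 3 g) →
        ∀ (μA : Measure (adelicGroupData (↥(maximalRealSubfield L)) L (IsCMField.complexConj L) 3 H).automorphicQuotient)
          [(adelicGroupData (↥(maximalRealSubfield L)) L (IsCMField.complexConj L) 3 H).IsAutomorphicMeasure μA]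
          (μA' : Measure (adelicGroupData (↥(maximalRealSubfield L)) L (IsCMField.complexConj L) 3 H).automorphicQuotient)
          [(adelicGroupData (↥(maximalRealSubfield L)) L (IsCMField.complexConj L) 3 H).IsAutomorphicMeasure μA']
          (P : DiscreteAutomorphicRep (adelicGroupData (↥(maximalRealSubfield L)) L (IsCMField.complexConj L) 3 H) μA)
          (P' : DiscreteAutomorphicRep (adelicGroupData (↥(maximalRealSubfield L)) L (IsCMField.complexConj L) 3 H) μA'),
            ∀ (μ : Literature.NumberTheory.Automorphic.IdeleClassGroup L →ₜ* Circle) (hμ : IsConjugateSymplectic L μ), HasWeight L μ 1 →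
              ∀ (a a' : (↥(maximalRealSubfield L))ˣ) (χ : Chi (↥(maximalRealSubfield L)) L (IsCMField.complexConj L)),
                P.HasFinComponent
                  (rhoAtLine (↥(maximalRealSubfield L)) L (IsCMField.complexConj L) 3 e₁ (Matrix.diagonal dV)
                    (complexConj_imagUnit L) (imagUnit_ne_zero L) (imagUnit_mul_self L) (realDiagonal_isSymm L dV hdV)
                    (isUnit_det_realDiagonal L dV hdV hdV0) (realDiagonal_map L dV hdV).symm
                    (fun a => isCompatible_chiSplittingLine L e₁ dV hdV hdV0 (toHeckeCharacter L μ)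
                      (isUnitary_toHeckeCharacter L μ) ((isOscillatorChar_toHeckeCharacter_iff μ).mpr hμ)
                      (TW (↥(maximalRealSubfield L)) a) (isSymm_TW (↥(maximalRealSubfield L)) a)
                      (isUnit_det_TW (↥(maximalRealSubfield L)) a) (JW (↥(maximalRealSubfield L)) L a)
                      (JW_eq (↥(maximalRealSubfield L)) L a)) ιV a χ) →
                P'.HasFinComponent
                  (rhoAtLine (↥(maximalRealSubfield L)) L (IsCMField.complexConj L) 3 e₁ (Matrix.diagonal dV)
                    (complexConj_imagUnit L) (imagUnit_ne_zero L) (imagUnit_mul_self L) (realDiagonal_isSymm L dV hdV)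
                    (isUnit_det_realDiagonal L dV hdV hdV0) (realDiagonal_map L dV hdV).symm
                    (fun a => isCompatible_chiSplittingLine L e₁ dV hdV hdV0 (toHeckeCharacter L μ)
                      (isUnitary_toHeckeCharacter L μ) ((isOscillatorChar_toHeckeCharacter_iff μ).mpr hμ)
                      (TW (↥(maximalRealSubfield L)) a) (isSymm_TW (↥(maximalRealSubfield L)) a)
                      (isUnit_det_TW (↥(maximalRealSubfield L)) a) (JW (↥(maximalRealSubfield L)) L a)
                      (JW_eq (↥(maximalRealSubfield L)) L a)) ιV a' χ) →
                  ∀ v : HeightOneSpectrum (𝓞 ↥(maximalRealSubfield L)),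
                    (((∃ c : IrrClass ((cmDatum L 3 H).Local v),
                        (IrrClass.comap (localPiEquiv L (IsCMField.complexConj L) 3 H v) c).IsConstituentOf
                            (P.finRep.smoothPart.toRepresentation.comp (inclPlace (↥(maximalRealSubfield L)) L (IsCMField.complexConj L) 3 H v)) ∧
                          c.IsSupercuspidal) ↔
                      (∃ c : IrrClass ((cmDatum L 3 H).Local v),
                        (IrrClass.comap (localPiEquiv L (IsCMField.complexConj L) 3 H v) c).IsConstituentOf
                            (P'.finRep.smoothPart.toRepresentation.comp (inclPlace (↥(maximalRealSubfield L)) L (IsCMField.complexConj L) 3 H v)) ∧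
                          c.IsSupercuspidal)) ↔
                      locF (↥(maximalRealSubfield L)) (imagUnitSq L) a v = locF (↥(maximalRealSubfield L)) (imagUnitSq L) a' v) := by
  intro L _ _ _ H n' e₁ dV hdV hdV0 g hg ιV hιV μA _ μA' _ P P' μ hμ _hw a a' χ hfin hfin' v
  -- the frame is `3 × 1`
  obtain rfl : n' = 3 := by
    have h := Fintype.card_congr e₁
    simp only [Fintype.card_prod, Fintype.card_fin] at h
    omega
  rw [cuspLabel_iff_isSupercuspidal_xThetaCM L H e₁ dV hdV hdV0 g hg ιV hιV μA P μ hμ a χ hfin v,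
    cuspLabel_iff_isSupercuspidal_xThetaCM L H e₁ dV hdV hdV0 g hg ιV hιV μA' P' μ hμ a' χ hfin' v]
  exact isSupercuspidal_xThetaCM_iff_iff_locF_apply_eq L e₁ dV hdV hdV0 μ hμ χ a a' v

end Summit.HodgeConjecture.HodgeConjecture.Cruxes.H413.F0P2rCuspDictHolds

end
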